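import Literature.RingTheory.KTheory.MilnorKStiefelWhitneyProducts
import Mathlib.Algebra.BigOperators.NatAntidiagonal
import HarnessLib

/-!
# COROLLARY 3.3 (`w₁, …, w_{t−1}` annihilate `ÎⁿF`; `w_t : ÎⁿF/Îⁿ⁺¹F → k_tF`) and THEOREM 4.1 «the homomorphisms `s₁`
# and `s₂` are bijective» (Milnor, *Algebraic K-theory and quadratic forms*, Invent. Math. 9 (1970), §3–§4)

Family `hodge`, lane `lit-hodgefound` (foundations library; seat `lit-hodgefound-p27`, generation 41, row g41-#4);
topic `RingTheory/KTheory`.  Sequel of `MilnorKStiefelWhitneyProducts` (g41-#3: LEMMA 3.2), `MilnorKStiefelWhitneyHom`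
(g41-#2: `swSeries`, `swCoeff`, `KC`, `kOfDegC`), `MilnorKWittGrothendieckRing` (g41-#1: `Î`, `toWitt`, `Î ≅ I`,
`mem_pow_augIdeal_iff_mem_closure`) and g40's `MilnorKWittRing` (`WittRing.sHom F n = sₙ : kₙF → Iⁿ/Iⁿ⁺¹`, `grMk`,
`grMk_eq_zero_iff`, `exists_sHom_eq`).  PROVED THEOREMS and definitions with bodies; no named fact, no instance, no
notation, 0 `sorry`, net debt 0 (D-0026).

## The source, verbatim

J. Milnor, *Algebraic K-theory and quadratic forms*, Invent. Math. 9 (1970) 318–344 (held `paper:doi-10-1007-bf01425486`;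
bib key `Milnor1970`), §3 (p0013 L30–L38): «COROLLARY 3.3. If t = 2ⁿ⁻¹, then the invariants w₁, …, w_{t−1} annihilate
the ideal ÎⁿF, while w_t induces a homomorphism w_t : ÎⁿF/Îⁿ⁺¹F → k_tF which carries the product
((a₁) − (1))⋯((aₙ) − (1)) to l(a₁)⋯l(aₙ)l(−1)^{t−n}. *Proof.* Since the elements (a) − (1) form an additive set of
generators for ÎF, it is clear that the n-fold products of such elements generate ÎⁿF. The conclusion now follows
immediately.»  §4 (p0014 L27–L35, p0015 L14–L27): «THEOREM 4.1. […] The homomorphisms s₁ and s₂ are bijective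
(compare [13]); and every s_n is surjective. […] Now let t = 2ⁿ⁻¹, and consider the homomorphism
w_t : Iⁿ/Iⁿ⁺¹ ≅ Îⁿ/Îⁿ⁺¹ → k_t of §3.3. Evidently the composition w_t ∘ s_n is just multiplication by l(−1)^{t−n}.
But if n equal 1 or 2, then t = n, and the appropriate statement is that w_t ∘ s_t is the identity. This shows that
s₁ and s₂ are bijective; which completes the proof of 4.1. REMARK 4.2. For n > 2, this argument proves the
following: If multiplication by l(−1)^{t−n} carries k_nF injectively into k_tF, then the homomorphism
s_n : k_nF → Iⁿ/Iⁿ⁺¹ is necessarily bijective.»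

## What is formalised

Throughout the degree is written `n + 1 ≥ 1` and `t = 2ⁿ`.
* `truncOne F t`: the multiplicative set of series `1 + (terms of degree ≥ t)`; closed under products and inverses
  (`mem_truncOne_of_mul_eq_one`), and **`coeff_mul_of_mem_truncOne : coeff_t(φψ) = coeff_t φ + coeff_t ψ`** on it.
* **COROLLARY 3.3**: for `x ∈ Îⁿ⁺¹`, `w(x) ∈ truncOne (2ⁿ)` (`swSeries_mem_truncOne`, by LEMMA 3.2 on the additive
  generators `((a₁) − (1))⋯((aₙ₊₁) − (1))` of `Îⁿ⁺¹` and closure), hence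
  **`swCoeff_eq_zero_of_mem_pow`** («w₁, …, w_{t−1} annihilate the ideal ÎⁿF»), **`swCoeff_add_of_mem_pow`** and the
  additive map **`swTop F n : Îⁿ⁺¹ →+ k_*F`** («w_t induces a homomorphism»), **`swCoeff_eq_zero_of_mem_pow_succ`**
  (it kills `Îⁿ⁺²`, i.e. factors through `Îⁿ⁺¹/Îⁿ⁺²`), **`swCoeff_finProd_gen_sub_one`** («carries the product
  ((a₁) − (1))⋯((aₙ) − (1)) to l(a₁)⋯l(aₙ)l(−1)^{t−n}», both parities), values in `k_tF` (`swTop_mem_kRangeC`).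
* **THEOREM 4.1 / REMARK 4.2**: the lift `exists_lift_sK` (every `z ∈ KₙF` has `x̂ ∈ Îⁿ` over `sₙ(z)` with
  `w_t(x̂) = l(−1)^{t−n}·z` in `k_tF`), **`swCoeff_eq_of_grMk_toWitt_eq`** («the composition w_t ∘ s_n is just
  multiplication by l(−1)^{t−n}», through `Iⁿ/Iⁿ⁺¹ ≅ Îⁿ/Îⁿ⁺¹`), **`mulPow_eq_zero_of_sHom_eq_zero`**,
  **`sHom_injective_of_mulPow_injective`** (REMARK 4.2), the transported **`swW : Iⁿ⁺¹ →+ k_*F`** («w_t : Iⁿ/Iⁿ⁺¹ ≅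
  Îⁿ/Îⁿ⁺¹ → k_t») with `swW_eq_mulPow`, `swW_eq_zero_of_mem_pow_succ`, and **`sHom_one_injective`, `sHom_two_injective`**,
  **`existsUnique_sHom_one_eq`, `existsUnique_sHom_two_eq`** («s₁ and s₂ are bijective»: with g40's surjectivity
  `exists_sHom_eq`, every class of `I/I²`, `I²/I³` has exactly one preimage), and the detecting criteria
  **`mem_sq_iff_swCoeff_one_eq_zero`** (`x ∈ Î`: `x ∈ Î² ↔ w₁(x) = 0`), **`mem_cube_iff_swCoeff_two_eq_zero`**
  (`x ∈ Î²`: `x ∈ Î³ ↔ w₂(x) = 0`), **`mem_cube_iff`** (`x ∈ Î³ ↔ rank x = 0 ∧ w₁ x = 0 ∧ w₂ x = 0`) — all for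
  `char F ≠ 2`; and `sHom_zero_injective` / `existsUnique_sHom_zero_eq` (`s₀ : k₀F ≅ W/I`, any field).
* Not here: Questions 4.3/4.4, Lemma 4.5 (global fields), Lemma 4.6.

## References

* [Milnor1970] J. Milnor, *Algebraic K-theory and quadratic forms*, Invent. Math. 9 (1970) 318–344 — §3 Corollary 3.3
  (p0013 L30–L38); §4 Theorem 4.1 and the end of its proof, Remark 4.2 (p0014 L27–L35, p0015 L14–L27).

Provenance: lane `lit-hodgefound`, seat `lit-hodgefound-p27` gen 41 (agent `literature-prover-lit-hodgefound-p27-g41-0`),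
row g41-#4.
-/

set_option autoImplicit false

noncomputable section

namespace Literature.RingTheory.KTheory

open Function Finset PowerSeries

section Field

variable (F : Type*) [Field F]

namespace MilnorKStar

/-! ### the groups `1 + (degree ≥ t)` of units of `k_ΠF` and the homomorphisms `coeff_t` on them -/

/-- The series `1 + (terms of degree ≥ t)`: constant coefficient `1`, no coefficients in degrees `0 < j < t` — where the
values `w(x)`, `x ∈ Îⁿ`, live («w₁, …, w_{t−1} annihilate the ideal ÎⁿF»). [cite: Milnor1970, §3 Cor. 3.3 (p0013 L30–L35)] -/
def truncOne (t : ℕ) : Submonoid (PowerSeries (KC F)) where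
  carrier := {φ | constantCoeff φ = 1 ∧ ∀ j, 0 < j → j < t → coeff j φ = 0}
  one_mem' := ⟨map_one _, fun j hj _ => by rw [coeff_one, if_neg hj.ne']⟩
  mul_mem' {φ ψ} hφ hψ := by
    refine ⟨by rw [map_mul, hφ.1, hψ.1, mul_one], fun j hj hjt => ?_⟩
    rw [coeff_mul]
    refine Finset.sum_eq_zero fun ij hij => ?_
    rw [mem_antidiagonal] at hij
    by_cases hi : ij.1 = 0
    · have hj' : ij.2 = j := by omega
      rw [hj', hψ.2 j hj hjt, mul_zero]
    · rw [hφ.2 ij.1 (Nat.pos_of_ne_zero hi) (by omega), zero_mul]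

/-- Membership in `truncOne`. [cite: Milnor1970, §3 Cor. 3.3 (p0013 L30–L35)] -/
theorem mem_truncOne_iff (t : ℕ) (φ : PowerSeries (KC F)) :
    φ ∈ truncOne F t ↔ constantCoeff φ = 1 ∧ ∀ j, 0 < j → j < t → coeff j φ = 0 := Iff.rfl

/-- `truncOne` decreases in `t`. [cite: Milnor1970, §3 Cor. 3.3 (p0013 L30–L35)] -/
theorem truncOne_anti {t t' : ℕ} (h : t ≤ t') : truncOne F t' ≤ truncOne F t := fun _ hφ =>
  ⟨hφ.1, fun j hj hjt => hφ.2 j hj (lt_of_lt_of_le hjt h)⟩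

/-- `1 + bX^t ∈ truncOne t`. [cite: Milnor1970, §3 Lemma 3.2 / Cor. 3.3 (p0012 L35–L43, p0013 L30–L35)] -/
theorem one_add_C_mul_X_pow_mem_truncOne {t : ℕ} (ht : 0 < t) (b : KC F) : 1 + C b * X ^ t ∈ truncOne F t := by
  refine ⟨by rw [map_add, map_one, map_mul, map_pow, constantCoeff_X, zero_pow ht.ne', mul_zero, add_zero], fun j hj hjt => ?_⟩
  rw [map_add, coeff_one, if_neg hj.ne', coeff_C_mul_X_pow, if_neg hjt.ne, add_zero]

/-- The coefficient sum of a product, with the two extreme terms split off. [folklore] -/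
private theorem coeff_mul_eq_add_add_sum {t : ℕ} (ht : 0 < t) (φ ψ : PowerSeries (KC F)) :
    coeff t (φ * ψ) = coeff 0 φ * coeff t ψ + coeff t φ * coeff 0 ψ +
      ∑ k ∈ Finset.range (t - 1), coeff (k + 1) φ * coeff (t - (k + 1)) ψ := by
  obtain ⟨t', rfl⟩ : ∃ t', t = t' + 1 := ⟨t - 1, by omega⟩
  rw [coeff_mul, Finset.Nat.sum_antidiagonal_eq_sum_range_succ_mk, Finset.sum_range_succ, Finset.sum_range_succ']
  dsimp only
  rw [Nat.sub_zero, Nat.sub_self, Nat.add_sub_cancel]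
  ring

/-- **On `truncOne t` the degree-`t` coefficient is additive: `coeff_t(φψ) = coeff_t φ + coeff_t ψ`** (the cross terms
vanish) — «w_t induces a homomorphism». [cite: Milnor1970, §3 Cor. 3.3 (p0013 L30–L35)] -/
theorem coeff_mul_of_mem_truncOne {t : ℕ} (ht : 0 < t) {φ ψ : PowerSeries (KC F)} (hφ : φ ∈ truncOne F t)
    (hψ : ψ ∈ truncOne F t) : coeff t (φ * ψ) = coeff t φ + coeff t ψ := by
  rw [coeff_mul_eq_add_add_sum F ht, coeff_zero_eq_constantCoeff_apply, coeff_zero_eq_constantCoeff_apply, hφ.1, hψ.1,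
    one_mul, mul_one, add_comm (coeff t ψ)]
  rw [Finset.sum_eq_zero fun k hk => ?_, add_zero]
  rw [Finset.mem_range] at hk
  rw [hφ.2 (k + 1) (Nat.succ_pos k) (by omega), zero_mul]

/-- A series with constant term `1` whose product with a member of `truncOne t` is `1` lies in `truncOne t` (inverses).
[cite: Milnor1970, §3 Cor. 3.3 (p0013 L30–L35); Lemma 3.1 «a well defined unit» (p0011 L24–L25)] -/
theorem mem_truncOne_of_mul_eq_one {t : ℕ} {φ ψ : PowerSeries (KC F)} (hφ : φ ∈ truncOne F t) (h : ψ * φ = 1)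
    (hψ : constantCoeff ψ = 1) : ψ ∈ truncOne F t := by
  refine ⟨hψ, fun j => ?_⟩
  induction j using Nat.strong_induction_on with
  | _ j ih =>
    intro hj hjt
    have hc : coeff j (ψ * φ) = 0 := by rw [h, coeff_one, if_neg hj.ne']
    rw [coeff_mul_eq_add_add_sum F hj, coeff_zero_eq_constantCoeff_apply, coeff_zero_eq_constantCoeff_apply, hφ.1, hψ,
      hφ.2 j hj hjt, mul_zero, zero_add, mul_one] at hc
    rw [Finset.sum_eq_zero fun k hk => ?_, add_zero] at hc
    · exact hc
    · rw [Finset.mem_range] at hk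
      rw [hφ.2 (j - (k + 1)) (by omega) (by omega), mul_zero]

/-- `invOfUnit φ 1 ∈ truncOne t` for `φ ∈ truncOne t`. [cite: Milnor1970, §3 Cor. 3.3 (p0013 L30–L35)] -/
theorem invOfUnit_mem_truncOne {t : ℕ} {φ : PowerSeries (KC F)} (hφ : φ ∈ truncOne F t) : invOfUnit φ 1 ∈ truncOne F t :=
  mem_truncOne_of_mul_eq_one F hφ (invOfUnit_mul φ 1 (by rw [hφ.1, Units.val_one]))
    (by rw [constantCoeff_invOfUnit, inv_one, Units.val_one])

/-- On `truncOne t`: if `ψφ = 1` then `coeff_t ψ = coeff_t φ` (`= −coeff_t φ`, characteristic `2`). [cite: Milnor1970, §3 Lemma 3.2 «or (1 + ⋯)⁻¹» / Cor. 3.3 (p0012 L35–L43, p0013 L30–L35)] -/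
theorem coeff_eq_of_mul_eq_one {t : ℕ} (ht : 0 < t) {φ ψ : PowerSeries (KC F)} (hφ : φ ∈ truncOne F t) (h : ψ * φ = 1)
    (hψ : constantCoeff ψ = 1) : coeff t ψ = coeff t φ := by
  have hψ' := mem_truncOne_of_mul_eq_one F hφ h hψ
  have hc : coeff t (ψ * φ) = 0 := by rw [h, coeff_one, if_neg ht.ne']
  rw [coeff_mul_of_mem_truncOne F ht hψ' hφ] at hc
  rw [← neg_eq_self_KC F (coeff t φ)]
  exact eq_neg_of_add_eq_zero_left hc

/-! ### COROLLARY 3.3 -/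

/-- **For `x ∈ Îⁿ⁺¹`, `w(x) ∈ 1 + (degree ≥ 2ⁿ)`** (LEMMA 3.2 on the additive generators `((a₁) − (1))⋯((aₙ₊₁) − (1))` of
`Îⁿ⁺¹`, and closure under products and inverses). [cite: Milnor1970, §3 Cor. 3.3 and its proof «the n-fold products of such elements generate ÎⁿF» (p0013 L30–L38)] -/
theorem swSeries_mem_truncOne {n : ℕ} {x : WittGrothendieckRing F} (hx : x ∈ WittGrothendieckRing.augIdeal F ^ (n + 1)) :
    swSeries F x ∈ truncOne F (2 ^ n) := by
  have ht : 0 < 2 ^ n := Nat.two_pow_pos n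
  rw [WittGrothendieckRing.mem_pow_augIdeal_iff_mem_closure] at hx
  induction hx using AddSubgroup.closure_induction with
  | mem y hy =>
    obtain ⟨a, rfl⟩ := hy
    rcases Nat.even_or_odd (n + 1) with he | ho
    · have h := swSeries_finProd_gen_sub_one_mul_of_even F (n := n + 1) (Nat.succ_pos n) he a
      rw [Nat.add_sub_cancel] at h
      exact mem_truncOne_of_mul_eq_one F (one_add_C_mul_X_pow_mem_truncOne F ht _) h (constantCoeff_swSeries F _)
    · rw [swSeries_finProd_gen_sub_one_of_odd F (n := n + 1) ho, Nat.add_sub_cancel]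
      exact one_add_C_mul_X_pow_mem_truncOne F ht _
  | zero => rw [swSeries_zero]; exact Submonoid.one_mem _
  | add y z _ _ hy hz => rw [swSeries_add]; exact Submonoid.mul_mem _ hy hz
  | neg y _ hy => rw [swSeries_neg]; exact invOfUnit_mem_truncOne F hy

/-- **COROLLARY 3.3 (first part): «the invariants w₁, …, w_{t−1} annihilate the ideal ÎⁿF»**: `wⱼ(x) = 0` for
`x ∈ Îⁿ⁺¹` and `0 < j < 2ⁿ`. [cite: Milnor1970, §3 Cor. 3.3 (p0013 L30–L32)] -/
theorem swCoeff_eq_zero_of_mem_pow {n : ℕ} {x : WittGrothendieckRing F} (hx : x ∈ WittGrothendieckRing.augIdeal F ^ (n + 1))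
    {j : ℕ} (hj0 : 0 < j) (hj : j < 2 ^ n) : swCoeff F j x = 0 :=
  (swSeries_mem_truncOne F hx).2 j hj0 hj

/-- **COROLLARY 3.3: `w_t` is additive on `Îⁿ⁺¹`** (`t = 2ⁿ`): `w_t(x + y) = w_t(x) + w_t(y)`. [cite: Milnor1970, §3 Cor. 3.3 «w_t induces a homomorphism» (p0013 L31–L33)] -/
theorem swCoeff_add_of_mem_pow {n : ℕ} {x y : WittGrothendieckRing F} (hx : x ∈ WittGrothendieckRing.augIdeal F ^ (n + 1))
    (hy : y ∈ WittGrothendieckRing.augIdeal F ^ (n + 1)) :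
    swCoeff F (2 ^ n) (x + y) = swCoeff F (2 ^ n) x + swCoeff F (2 ^ n) y := by
  rw [swCoeff_def, swSeries_add, coeff_mul_of_mem_truncOne F (Nat.two_pow_pos n) (swSeries_mem_truncOne F hx)
    (swSeries_mem_truncOne F hy), swCoeff_def, swCoeff_def]

/-- **COROLLARY 3.3: the homomorphism `w_t : Îⁿ⁺¹ → k_*F`, `t = 2ⁿ`** (values in `k_tF`: `swTop_mem_kRangeC`; kills
`Îⁿ⁺²`: `swTop_eq_zero_of_mem_pow_succ`). [cite: Milnor1970, §3 Cor. 3.3 «w_t induces a homomorphism w_t : ÎⁿF/Îⁿ⁺¹F → k_tF» (p0013 L31–L33)] -/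
def swTop (n : ℕ) : ↥(WittGrothendieckRing.augIdeal F ^ (n + 1)) →+ KC F where
  toFun x := swCoeff F (2 ^ n) x
  map_zero' := by
    change swCoeff F (2 ^ n) 0 = 0
    rw [swCoeff_def, swSeries_zero, coeff_one, if_neg (Nat.two_pow_pos n).ne']
  map_add' x y := swCoeff_add_of_mem_pow F x.2 y.2

/-- `swTop` on elements. [cite: Milnor1970, §3 Cor. 3.3 (p0013 L31–L33)] -/
theorem swTop_apply {n : ℕ} (x : ↥(WittGrothendieckRing.augIdeal F ^ (n + 1))) : swTop F n x = swCoeff F (2 ^ n) x := rfl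

/-- `w_t(x) ∈ k_tF`. [cite: Milnor1970, §3 Cor. 3.3 «→ k_tF» (p0013 L31–L33)] -/
theorem swTop_mem_kRangeC {n : ℕ} (x : ↥(WittGrothendieckRing.augIdeal F ^ (n + 1))) : swTop F n x ∈ kRangeC F (2 ^ n) :=
  swCoeff_mem_kRangeC F _ _

/-- **COROLLARY 3.3: `w_t` kills `Îⁿ⁺²`** (it «induces a homomorphism ÎⁿF/Îⁿ⁺¹F → k_tF»): for `x ∈ Îⁿ⁺²`, `w_{2ⁿ}(x) = 0`
(as `0 < 2ⁿ < 2ⁿ⁺¹`). [cite: Milnor1970, §3 Cor. 3.3 (p0013 L30–L33)] -/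
theorem swCoeff_eq_zero_of_mem_pow_succ {n : ℕ} {x : WittGrothendieckRing F}
    (hx : x ∈ WittGrothendieckRing.augIdeal F ^ (n + 2)) : swCoeff F (2 ^ n) x = 0 :=
  swCoeff_eq_zero_of_mem_pow F (n := n + 1) hx (Nat.two_pow_pos n) (Nat.pow_lt_pow_right (by norm_num) (Nat.lt_succ_self n))

/-- `w_t` agrees on elements of `Îⁿ⁺¹` that are congruent modulo `Îⁿ⁺²`. [cite: Milnor1970, §3 Cor. 3.3 (p0013 L30–L33)] -/
theorem swCoeff_eq_of_sub_mem_pow_succ {n : ℕ} {x y : WittGrothendieckRing F}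
    (hx : x ∈ WittGrothendieckRing.augIdeal F ^ (n + 1)) (hy : y ∈ WittGrothendieckRing.augIdeal F ^ (n + 1))
    (h : x - y ∈ WittGrothendieckRing.augIdeal F ^ (n + 2)) : swCoeff F (2 ^ n) x = swCoeff F (2 ^ n) y := by
  have h1 := swCoeff_add_of_mem_pow F (sub_mem hx hy) hy
  rw [sub_add_cancel, swCoeff_eq_zero_of_mem_pow_succ F h, zero_add] at h1
  exact h1

/-- **COROLLARY 3.3: `w_t` «carries the product ((a₁) − (1))⋯((aₙ) − (1)) to l(a₁)⋯l(aₙ)l(−1)^{t−n}»** (degree `n+1`,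
`t = 2ⁿ`; both parities, since `−b = b` in `k_*F`). [cite: Milnor1970, §3 Cor. 3.3 (p0013 L31–L35)] -/
theorem swCoeff_finProd_gen_sub_one {n : ℕ} (a : Fin (n + 1) → Fˣ) :
    swCoeff F (2 ^ n) (List.ofFn fun j => WittGrothendieckRing.gen F (a j) - 1).prod =
      (List.ofFn fun j => klc F (a j)).prod * klc F (-1) ^ (2 ^ n - (n + 1)) := by
  have ht : 0 < 2 ^ n := Nat.two_pow_pos n
  rcases Nat.even_or_odd (n + 1) with he | ho
  · have h := swSeries_finProd_gen_sub_one_mul_of_even F (n := n + 1) (Nat.succ_pos n) he a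
    rw [Nat.add_sub_cancel] at h
    rw [swCoeff_def, coeff_eq_of_mul_eq_one F ht (one_add_C_mul_X_pow_mem_truncOne F ht _) h (constantCoeff_swSeries F _),
      map_add, coeff_one, if_neg ht.ne', coeff_C_mul_X_pow, if_pos rfl, zero_add]
  · have h := swSeries_finProd_gen_sub_one_of_odd F (n := n + 1) ho a
    rw [Nat.add_sub_cancel] at h
    rw [swCoeff_def, h, map_add, coeff_one, if_neg ht.ne', coeff_C_mul_X_pow, if_pos rfl, zero_add]

/-- The same value through `kₙ₊₁F → k_*F`: `w_t(∏((aᵢ) − (1))) = {a₁, …, aₙ₊₁} · l(−1)^{t−n−1}`. [cite: Milnor1970, §3 Cor. 3.3 (p0013 L31–L35); §4 «w_t ∘ s_n is just multiplication by l(−1)^{t−n}» (p0015 L19–L21)] -/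
theorem swCoeff_finProd_gen_sub_one' {n : ℕ} (a : Fin (n + 1) → Fˣ) :
    swCoeff F (2 ^ n) (List.ofFn fun j => WittGrothendieckRing.gen F (a j) - 1).prod =
      kOfDegC F (n + 1) (MilnorK.kSymbol a) * klc F (-1) ^ (2 ^ n - (n + 1)) := by
  rw [swCoeff_finProd_gen_sub_one, kOfDegC_kSymbol]

end MilnorKStar

/-! ### THEOREM 4.1: `s₁` and `s₂` are bijective; REMARK 4.2 -/

namespace WittRing

open MilnorKStar WittGrothendieckRing

/-- **The multiplication-by-`l(−1)^{t−n}` map `kₙ₊₁F → k_tF ⊂ k_*F`, `t = 2ⁿ`** («w_t ∘ s_n is just multiplication by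
l(−1)^{t−n}»), read in the commutative structure `KC F` of `k_*F` through the injection `kOfDegC`. [cite: Milnor1970, §4 end of the proof of Theorem 4.1 (p0015 L19–L21); Remark 4.2 (p0015 L25–L27)] -/
def mulPow (n : ℕ) : MilnorK.Mod2 F (n + 1) →+ KC F :=
  (AddMonoidHom.mulRight (klc F (-1) ^ (2 ^ n - (n + 1)))).comp (kOfDegC F (n + 1))

/-- `mulPow` on elements. [cite: Milnor1970, §4 (p0015 L19–L21)] -/
theorem mulPow_apply {n : ℕ} (x : MilnorK.Mod2 F (n + 1)) : mulPow F n x = kOfDegC F (n + 1) x * klc F (-1) ^ (2 ^ n - (n + 1)) := rfl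

/-- For `n + 1 ∈ {1, 2}` (`t = n + 1`), `mulPow` is the injection `kₙ₊₁F → k_*F` itself. [cite: Milnor1970, §4 «if n equal 1 or 2, then t = n» (p0015 L22–L23)] -/
theorem mulPow_eq_kOfDegC {n : ℕ} (hn : 2 ^ n = n + 1) (x : MilnorK.Mod2 F (n + 1)) : mulPow F n x = kOfDegC F (n + 1) x := by
  rw [mulPow_apply, hn, Nat.sub_self, pow_zero, mul_one]

/-- **The lift: every `z ∈ Kₙ₊₁F` has an `x̂ ∈ Îⁿ⁺¹` lying over `sₙ₊₁(z) ∈ Iⁿ⁺¹/Iⁿ⁺²` with `w_t(x̂) = l(−1)^{t−n−1}·z`**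
(on symbols `x̂ = ((a₁) − (1))⋯((aₙ₊₁) − (1))`, by COROLLARY 3.3; extended additively). [cite: Milnor1970, §4 end of the proof of Theorem 4.1 «consider the homomorphism w_t : Iⁿ/Iⁿ⁺¹ ≅ Îⁿ/Îⁿ⁺¹ → k_t» (p0015 L14–L21)] -/
theorem exists_lift_sK {n : ℕ} (z : MilnorK F (n + 1)) :
    ∃ (x : WittGrothendieckRing F) (hx : x ∈ augIdeal F ^ (n + 1)),
      grMk F (n + 1) (toWitt F x) (toWitt_mem_pow F hx) = sK F (n + 1) z ∧
        swCoeff F (2 ^ n) x = mulPow F n (MilnorK.kmk F (n + 1) z) := by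
  induction z using MilnorK.induction_on with
  | hsym k a =>
    refine ⟨k • (List.ofFn fun j => WittGrothendieckRing.gen F (a j) - 1).prod, ?_, ?_, ?_⟩
    · exact Submodule.smul_of_tower_mem _ k (WittGrothendieckRing.prod_gen_sub_one_mem F a)
    · rw [(sK F (n + 1)).map_zsmul, sK_symbol, prod_ell, zsmul_grMk]
      exact grMk_congr F (by rw [map_zsmul (toWitt F), toWitt_prod_gen_sub_one, zsmul_eq_mul]) _ _
    · have h := map_zsmul (swTop F n) k
        ⟨(List.ofFn fun j => WittGrothendieckRing.gen F (a j) - 1).prod, WittGrothendieckRing.prod_gen_sub_one_mem F a⟩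
      rw [swTop_apply, swTop_apply] at h
      change swCoeff F (2 ^ n) (k • (List.ofFn fun j => WittGrothendieckRing.gen F (a j) - 1).prod) = _ at h
      rw [h, swCoeff_finProd_gen_sub_one', (MilnorK.kmk F (n + 1)).map_zsmul, ← MilnorK.kSymbol_def, (mulPow F n).map_zsmul,
        mulPow_apply]
  | hadd u v hu hv =>
    obtain ⟨x, hx, hx1, hx2⟩ := hu
    obtain ⟨y, hy, hy1, hy2⟩ := hv
    refine ⟨x + y, add_mem hx hy, ?_, ?_⟩
    · rw [(sK F (n + 1)).map_add, ← hx1, ← hy1, grMk_add]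
      exact grMk_congr F (map_add (toWitt F) x y) _ _
    · rw [swCoeff_add_of_mem_pow F hx hy, hx2, hy2, (MilnorK.kmk F (n + 1)).map_add, (mulPow F n).map_add]

/-- **«Evidently the composition w_t ∘ s_n is just multiplication by l(−1)^{t−n}»** — through the identification
`Iⁿ/Iⁿ⁺¹ ≅ Îⁿ/Îⁿ⁺¹` of `MilnorKWittGrothendieckRing`: for ANY `x̂ ∈ Îⁿ⁺¹` whose image represents `sₙ₊₁(x)`,
`w_{2ⁿ}(x̂) = l(−1)^{2ⁿ−n−1}·x` (`char F ≠ 2`). [cite: Milnor1970, §4 end of the proof of Theorem 4.1 (p0015 L14–L21)] -/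
theorem swCoeff_eq_of_grMk_toWitt_eq (h2 : (2 : F) ≠ 0) {n : ℕ} (x : MilnorK.Mod2 F (n + 1)) {y : WittGrothendieckRing F}
    (hy : y ∈ augIdeal F ^ (n + 1)) (h : grMk F (n + 1) (toWitt F y) (toWitt_mem_pow F hy) = sHom F (n + 1) x) :
    swCoeff F (2 ^ n) y = mulPow F n x := by
  obtain ⟨z, rfl⟩ := MilnorK.kmk_surjective x
  obtain ⟨y', hy', h1, h2'⟩ := exists_lift_sK F z
  rw [sHom_kmk, ← h1, grMk_eq_grMk_iff, ← map_sub] at h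
  have hmem : y - y' ∈ augIdeal F ^ (n + 2) :=
    mem_pow_of_toWitt_mem_pow F h2 (by omega) (Ideal.pow_le_self (Nat.succ_ne_zero n) (sub_mem hy hy')) h
  rw [swCoeff_eq_of_sub_mem_pow_succ F hy hy' hmem, h2']

/-- **The kernel computation: `sₙ₊₁(x) = 0 ⇒ l(−1)^{t−n−1}·x = 0` in `k_tF`** (`char F ≠ 2`): `sₙ₊₁(x) = 0` means the
representative lies in `Iⁿ⁺²`, its lift lies in `Îⁿ⁺²` (`Î ≅ I`), and `w_t` kills `Îⁿ⁺²`. [cite: Milnor1970, §4 end of the proof of Theorem 4.1 and Remark 4.2 (p0015 L14–L27)] -/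
theorem mulPow_eq_zero_of_sHom_eq_zero (h2 : (2 : F) ≠ 0) {n : ℕ} {x : MilnorK.Mod2 F (n + 1)} (hx : sHom F (n + 1) x = 0) :
    mulPow F n x = 0 := by
  obtain ⟨z, rfl⟩ := MilnorK.kmk_surjective x
  obtain ⟨y, hy, h1, h2'⟩ := exists_lift_sK F z
  rw [sHom_kmk, ← h1, grMk_eq_zero_iff] at hx
  have hmem : y ∈ augIdeal F ^ (n + 2) :=
    mem_pow_of_toWitt_mem_pow F h2 (by omega) (Ideal.pow_le_self (Nat.succ_ne_zero n) hy) hx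
  rw [← h2', MilnorKStar.swCoeff_eq_zero_of_mem_pow_succ F hmem]

/-- **REMARK 4.2: «If multiplication by l(−1)^{t−n} carries k_nF injectively into k_tF, then the homomorphism
s_n : k_nF → Iⁿ/Iⁿ⁺¹ is necessarily bijective»** — here its injectivity (surjectivity is g40's `exists_sHom_eq`);
`char F ≠ 2`. [cite: Milnor1970, §4 Remark 4.2 (p0015 L25–L27)] -/
theorem sHom_injective_of_mulPow_injective (h2 : (2 : F) ≠ 0) {n : ℕ} (hinj : Function.Injective (mulPow F n)) :
    Function.Injective (sHom F (n + 1)) := by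
  refine (injective_iff_map_eq_zero _).2 fun x hx => hinj ?_
  rw [mulPow_eq_zero_of_sHom_eq_zero F h2 hx, map_zero]

/-- For `n + 1 ∈ {1, 2}` the hypothesis of Remark 4.2 holds: `mulPow` is the injection `kₙ₊₁F → k_*F`. [cite: Milnor1970, §4 «if n equal 1 or 2, then t = n, and […] w_t ∘ s_t is the identity» (p0015 L22–L23)] -/
theorem mulPow_injective_of_eq {n : ℕ} (hn : 2 ^ n = n + 1) : Function.Injective (mulPow F n) := fun x y h => by
  rw [mulPow_eq_kOfDegC F hn, mulPow_eq_kOfDegC F hn] at h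
  exact kOfDegC_injective F (n + 1) h

/-- **THEOREM 4.1: `s₁ : k₁F → I/I²` is injective** (`char F ≠ 2`). [cite: Milnor1970, §4 Theorem 4.1 «The homomorphisms s₁ and s₂ are bijective» (p0014 L33–L35) and its proof (p0015 L14–L23)] -/
theorem sHom_one_injective (h2 : (2 : F) ≠ 0) : Function.Injective (sHom F 1) :=
  sHom_injective_of_mulPow_injective F h2 (mulPow_injective_of_eq F (n := 0) rfl)

/-- **THEOREM 4.1: `s₂ : k₂F → I²/I³` is injective** (`char F ≠ 2`). [cite: Milnor1970, §4 Theorem 4.1 «The homomorphisms s₁ and s₂ are bijective» (p0014 L33–L35) and its proof (p0015 L14–L23)] -/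
theorem sHom_two_injective (h2 : (2 : F) ≠ 0) : Function.Injective (sHom F 2) :=
  sHom_injective_of_mulPow_injective F h2 (mulPow_injective_of_eq F (n := 1) rfl)

/-- **THEOREM 4.1: `s₁ : k₁F ≅ I/I²`** — every class of `I/I²` has exactly one preimage under `s₁` (`char F ≠ 2`; with
g40's surjectivity `exists_sHom_eq`). [cite: Milnor1970, §4 Theorem 4.1 «The homomorphisms s₁ and s₂ are bijective» (p0014 L33–L35)] -/
theorem existsUnique_sHom_one_eq (h2 : (2 : F) ≠ 0) (y : WittRing F) (hy : y ∈ fundIdeal F ^ 1) :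
    ∃! x : MilnorK.Mod2 F 1, sHom F 1 x = grMk F 1 y hy := by
  obtain ⟨x, hx⟩ := exists_sHom_eq F y hy
  exact ⟨x, hx, fun x' hx' => sHom_one_injective F h2 (hx'.trans hx.symm)⟩

/-- **THEOREM 4.1: `s₂ : k₂F ≅ I²/I³`** — every class of `I²/I³` has exactly one preimage under `s₂` (`char F ≠ 2`; with
g40's surjectivity `exists_sHom_eq`). [cite: Milnor1970, §4 Theorem 4.1 «The homomorphisms s₁ and s₂ are bijective (compare [13])» (p0014 L33–L35)] -/
theorem existsUnique_sHom_two_eq (h2 : (2 : F) ≠ 0) (y : WittRing F) (hy : y ∈ fundIdeal F ^ 2) :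
    ∃! x : MilnorK.Mod2 F 2, sHom F 2 x = grMk F 2 y hy := by
  obtain ⟨x, hx⟩ := exists_sHom_eq F y hy
  exact ⟨x, hx, fun x' hx' => sHom_two_injective F h2 (hx'.trans hx.symm)⟩

/-- **REMARK 4.2 (bijective form)**: under the injectivity of multiplication by `l(−1)^{t−n}`, every class of `Iⁿ⁺¹/Iⁿ⁺²`
has exactly one preimage under `sₙ₊₁` (`char F ≠ 2`). [cite: Milnor1970, §4 Remark 4.2 (p0015 L25–L27)] -/
theorem existsUnique_sHom_eq_of_mulPow_injective (h2 : (2 : F) ≠ 0) {n : ℕ} (hinj : Function.Injective (mulPow F n))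
    (y : WittRing F) (hy : y ∈ fundIdeal F ^ (n + 1)) : ∃! x : MilnorK.Mod2 F (n + 1), sHom F (n + 1) x = grMk F (n + 1) y hy := by
  obtain ⟨x, hx⟩ := exists_sHom_eq F y hy
  exact ⟨x, hx, fun x' hx' => sHom_injective_of_mulPow_injective F h2 hinj (hx'.trans hx.symm)⟩

/-- **`k₁F ≅ I/I²` read on symbols: `(a) − (1) ≡ (b) − (1) mod I² ↔ l(a) = l(b)` in `k₁F`**, i.e. `↔ {a} = {b}`
(`char F ≠ 2`). [cite: Milnor1970, §4 Theorem 4.1 (p0014 L33–L35); §3 «Evidently w₁ is just the classical "discriminant"» (p0011 L15)] -/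
theorem ell_eq_ell_iff (h2 : (2 : F) ≠ 0) (a b : Fˣ) :
    ell F a = ell F b ↔ MilnorK.kSymbol (fun _ : Fin 1 => a) = MilnorK.kSymbol (fun _ : Fin 1 => b) := by
  have ha : sHom F 1 (MilnorK.kSymbol fun _ : Fin 1 => a) = ell F a := by
    rw [← sHom_one_kSymbol]; congr 1; exact congr_arg _ (funext fun i => by fin_cases i; rfl)
  have hb : sHom F 1 (MilnorK.kSymbol fun _ : Fin 1 => b) = ell F b := by
    rw [← sHom_one_kSymbol]; congr 1; exact congr_arg _ (funext fun i => by fin_cases i; rfl)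
  rw [← ha, ← hb]
  exact ⟨fun h => sHom_one_injective F h2 h, fun h => by rw [h]⟩

/-! #### `w_t` on `IⁿF/Iⁿ⁺¹F` through `Iⁿ/Iⁿ⁺¹ ≅ Îⁿ/Îⁿ⁺¹` -/

/-- A preimage in `Îⁿ⁺¹` of an element of `Iⁿ⁺¹` (the bijection «Iⁿ/Iⁿ⁺¹ ≅ Îⁿ/Îⁿ⁺¹»; any choice, unique by
`toWitt_injOn_augIdeal`). [cite: Milnor1970, §4 «w_t : Iⁿ/Iⁿ⁺¹ ≅ Îⁿ/Îⁿ⁺¹ → k_t» (p0015 L14–L17)] -/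
def liftPow (n : ℕ) (y : ↥(fundIdeal F ^ (n + 1))) : WittGrothendieckRing F :=
  Classical.choose (exists_eq_toWitt_of_mem_pow F (n := n + 1) y.2)

/-- `liftPow n y ∈ Îⁿ⁺¹`. [cite: Milnor1970, §4 (p0015 L14–L17)] -/
theorem liftPow_mem (n : ℕ) (y : ↥(fundIdeal F ^ (n + 1))) : liftPow F n y ∈ augIdeal F ^ (n + 1) :=
  (Classical.choose_spec (exists_eq_toWitt_of_mem_pow F (n := n + 1) y.2)).1

/-- `toWitt (liftPow n y) = y`. [cite: Milnor1970, §4 (p0015 L14–L17)] -/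
theorem toWitt_liftPow (n : ℕ) (y : ↥(fundIdeal F ^ (n + 1))) : toWitt F (liftPow F n y) = y :=
  (Classical.choose_spec (exists_eq_toWitt_of_mem_pow F (n := n + 1) y.2)).2

/-- The lift of `toWitt x`, `x ∈ Îⁿ⁺¹`, is `x` (`char F ≠ 2`). [cite: Milnor1970, §4 «Iⁿ/Iⁿ⁺¹ ≅ Îⁿ/Îⁿ⁺¹» (p0015 L14–L17)] -/
theorem liftPow_toWitt (h2 : (2 : F) ≠ 0) (n : ℕ) {x : WittGrothendieckRing F} (hx : x ∈ augIdeal F ^ (n + 1)) :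
    liftPow F n ⟨toWitt F x, toWitt_mem_pow F hx⟩ = x :=
  toWitt_injOn_augIdeal F h2 (Ideal.pow_le_self (Nat.succ_ne_zero n) (liftPow_mem F n _))
    (Ideal.pow_le_self (Nat.succ_ne_zero n) hx) (toWitt_liftPow F n _)

/-- **`w_t : Iⁿ⁺¹F → k_tF`, `t = 2ⁿ`, through `Iⁿ⁺¹ ≅ Îⁿ⁺¹`** («the homomorphism w_t : Iⁿ/Iⁿ⁺¹ ≅ Îⁿ/Îⁿ⁺¹ → k_t of §3.3»);
`char F ≠ 2`. [cite: Milnor1970, §4 end of the proof of Theorem 4.1 (p0015 L14–L17)] -/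
def swW (h2 : (2 : F) ≠ 0) (n : ℕ) : ↥(fundIdeal F ^ (n + 1)) →+ KC F where
  toFun y := swCoeff F (2 ^ n) (liftPow F n y)
  map_zero' := by
    have h : liftPow F n (0 : ↥(fundIdeal F ^ (n + 1))) = 0 := by
      have h0 := liftPow_toWitt F h2 n (x := 0) (zero_mem _)
      have e : (⟨toWitt F 0, toWitt_mem_pow F (zero_mem _)⟩ : ↥(fundIdeal F ^ (n + 1))) = 0 := Subtype.ext (map_zero _)
      rwa [e] at h0
    rw [h, swCoeff_def, swSeries_zero, coeff_one, if_neg (Nat.two_pow_pos n).ne']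
  map_add' y y' := by
    have h : liftPow F n (y + y') = liftPow F n y + liftPow F n y' := by
      have h0 := liftPow_toWitt F h2 n (add_mem (liftPow_mem F n y) (liftPow_mem F n y'))
      have e : (⟨toWitt F (liftPow F n y + liftPow F n y'), toWitt_mem_pow F (add_mem (liftPow_mem F n y) (liftPow_mem F n y'))⟩ :
          ↥(fundIdeal F ^ (n + 1))) = y + y' := Subtype.ext (by
        change toWitt F (liftPow F n y + liftPow F n y') = (y : WittRing F) + y'
        rw [map_add, toWitt_liftPow, toWitt_liftPow])
      rwa [e] at h0
    rw [h, swCoeff_add_of_mem_pow F (liftPow_mem F n y) (liftPow_mem F n y')]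

/-- `swW` on the image of `x ∈ Îⁿ⁺¹` is `w_t(x)`. [cite: Milnor1970, §4 (p0015 L14–L17)] -/
theorem swW_toWitt (h2 : (2 : F) ≠ 0) (n : ℕ) {x : WittGrothendieckRing F} (hx : x ∈ augIdeal F ^ (n + 1)) :
    swW F h2 n ⟨toWitt F x, toWitt_mem_pow F hx⟩ = swCoeff F (2 ^ n) x := by
  change swCoeff F (2 ^ n) (liftPow F n _) = _
  rw [liftPow_toWitt F h2 n hx]

/-- **«the composition w_t ∘ s_n is just multiplication by l(−1)^{t−n}»**: on a representative `y ∈ Iⁿ⁺¹` of `sₙ₊₁(x)`,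
`w_t(y) = l(−1)^{t−n−1}·x`; `char F ≠ 2`. [cite: Milnor1970, §4 end of the proof of Theorem 4.1 (p0015 L19–L21)] -/
theorem swW_eq_mulPow (h2 : (2 : F) ≠ 0) {n : ℕ} (x : MilnorK.Mod2 F (n + 1)) {y : WittRing F} (hy : y ∈ fundIdeal F ^ (n + 1))
    (h : sHom F (n + 1) x = grMk F (n + 1) y hy) : swW F h2 n ⟨y, hy⟩ = mulPow F n x := by
  change swCoeff F (2 ^ n) (liftPow F n ⟨y, hy⟩) = _
  refine swCoeff_eq_of_grMk_toWitt_eq F h2 x (liftPow_mem F n ⟨y, hy⟩) ?_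
  rw [h]
  exact grMk_congr F (toWitt_liftPow F n ⟨y, hy⟩) _ _

/-- `w_t ∘ sₙ₊₁` on symbols: `w_t(((a₁) − (1))⋯((aₙ₊₁) − (1)) in W) = l(a₁)⋯l(aₙ₊₁)·l(−1)^{t−n−1}`. [cite: Milnor1970, §4 (p0015 L19–L21); §3 Cor. 3.3 (p0013 L31–L35)] -/
theorem swW_prod_gen_sub_one (h2 : (2 : F) ≠ 0) {n : ℕ} (a : Fin (n + 1) → Fˣ) :
    swW F h2 n ⟨(List.ofFn fun j => gen F (a j) - 1).prod, prod_gen_sub_one_mem F a⟩ =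
      (List.ofFn fun j => klc F (a j)).prod * klc F (-1) ^ (2 ^ n - (n + 1)) := by
  rw [swW_eq_mulPow F h2 (MilnorK.kSymbol a) (prod_gen_sub_one_mem F a) (sHom_kSymbol F a), mulPow_apply, kOfDegC_kSymbol]

/-- `w_t` kills `Iⁿ⁺²` («w_t : Iⁿ/Iⁿ⁺¹ → k_t»); `char F ≠ 2`. [cite: Milnor1970, §4 (p0015 L14–L17); §3 Cor. 3.3 (p0013 L30–L33)] -/
theorem swW_eq_zero_of_mem_pow_succ (h2 : (2 : F) ≠ 0) {n : ℕ} {y : WittRing F} (hy : y ∈ fundIdeal F ^ (n + 2)) :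
    swW F h2 n ⟨y, Ideal.pow_le_pow_right (Nat.le_succ _) hy⟩ = 0 := by
  change swCoeff F (2 ^ n) (liftPow F n _) = 0
  refine MilnorKStar.swCoeff_eq_zero_of_mem_pow_succ F (mem_pow_of_toWitt_mem_pow F h2 (by omega)
    (Ideal.pow_le_self (Nat.succ_ne_zero n) (liftPow_mem F n _)) ?_)
  rw [toWitt_liftPow]
  exact hy

/-- `w_t(y) ∈ k_tF`. [cite: Milnor1970, §4 «→ k_t» (p0015 L14–L17)] -/
theorem swW_mem_kRangeC (h2 : (2 : F) ≠ 0) {n : ℕ} (y : ↥(fundIdeal F ^ (n + 1))) : swW F h2 n y ∈ kRangeC F (2 ^ n) :=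
  swCoeff_mem_kRangeC F _ _

/-- **`w_t` detects `Îⁿ⁺²` inside `Îⁿ⁺¹` when `t = n + 1 ∈ {1, 2}`**: for `x ∈ Îⁿ⁺¹`, `x ∈ Îⁿ⁺² ↔ w_t(x) = 0` — the
injectivity of `w_t : Îᵗ/Îᵗ⁺¹ → k_tF` («w_t ∘ s_t is the identity» and `s_t` is onto); `char F ≠ 2`. [cite: Milnor1970, §4 end of the proof of Theorem 4.1 (p0015 L19–L23); §3 Cor. 3.3 (p0013 L30–L35)] -/
theorem mem_pow_succ_iff_swCoeff_eq_zero (h2 : (2 : F) ≠ 0) {n : ℕ} (hn : 2 ^ n = n + 1) {x : WittGrothendieckRing F}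
    (hx : x ∈ augIdeal F ^ (n + 1)) : x ∈ augIdeal F ^ (n + 2) ↔ swCoeff F (2 ^ n) x = 0 := by
  refine ⟨fun h => MilnorKStar.swCoeff_eq_zero_of_mem_pow_succ F h, fun h => ?_⟩
  obtain ⟨u, hu⟩ := exists_sHom_eq F (toWitt F x) (toWitt_mem_pow F hx)
  have h1 := swCoeff_eq_of_grMk_toWitt_eq F h2 u hx hu.symm
  rw [h, mulPow_eq_kOfDegC F hn, eq_comm, ← (kOfDegC F (n + 1)).map_zero] at h1
  have hu0 : u = 0 := kOfDegC_injective F (n + 1) h1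
  rw [hu0, map_zero, eq_comm, grMk_eq_zero_iff] at hu
  exact mem_pow_of_toWitt_mem_pow F h2 (by omega) (Ideal.pow_le_self (Nat.succ_ne_zero n) hx) hu

/-- **An element of `Î` lies in `Î²` iff its first Stiefel–Whitney invariant (discriminant) vanishes** (`I/I² ≅ k₁F`;
«Evidently w₁ is just the classical "discriminant"»); `char F ≠ 2`. [cite: Milnor1970, §4 Theorem 4.1 «s₁ […] bijective» (p0014 L33–L35); §3 (p0011 L15)] -/
theorem mem_sq_iff_swCoeff_one_eq_zero (h2 : (2 : F) ≠ 0) {x : WittGrothendieckRing F} (hx : x ∈ augIdeal F) :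
    x ∈ augIdeal F ^ 2 ↔ swCoeff F 1 x = 0 := by
  have h := mem_pow_succ_iff_swCoeff_eq_zero F h2 (n := 0) rfl (x := x) (by rwa [zero_add, pow_one])
  rwa [pow_zero] at h

/-- **An element of `Î²` lies in `Î³` iff its second Stiefel–Whitney invariant vanishes** (`I²/I³ ≅ k₂F`; «w₂ is closely
related to the classical Hasse-Witt invariant»); `char F ≠ 2`. [cite: Milnor1970, §4 Theorem 4.1 «s₂ […] bijective» (p0014 L33–L35); §3 (p0011 L15–L16)] -/
theorem mem_cube_iff_swCoeff_two_eq_zero (h2 : (2 : F) ≠ 0) {x : WittGrothendieckRing F} (hx : x ∈ augIdeal F ^ 2) :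
    x ∈ augIdeal F ^ 3 ↔ swCoeff F 2 x = 0 :=
  mem_pow_succ_iff_swCoeff_eq_zero F h2 (n := 1) rfl hx

/-- **Modulo `Î³` an element of `Ŵ(F)` is determined by its rank, `w₁` and `w₂`**: `x ∈ Î³ ↔ rank x = 0 ∧ w₁(x) = 0 ∧
w₂(x) = 0` («w₁ is just the classical "discriminant" of M, and w₂ is closely related to the classical Hasse-Witt
invariant»; from `I/I² ≅ k₁F`, `I²/I³ ≅ k₂F`); `char F ≠ 2`. [cite: Milnor1970, §3 (p0011 L15–L16); §4 Theorem 4.1 «s₁ and s₂ are bijective» (p0014 L33–L35)] -/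
theorem mem_cube_iff (h2 : (2 : F) ≠ 0) (x : WittGrothendieckRing F) :
    x ∈ augIdeal F ^ 3 ↔ rank F x = 0 ∧ swCoeff F 1 x = 0 ∧ swCoeff F 2 x = 0 := by
  constructor
  · intro hx
    refine ⟨(mem_augIdeal_iff F x).1 (Ideal.pow_le_self three_ne_zero hx), ?_, MilnorKStar.swCoeff_eq_zero_of_mem_pow_succ F (n := 1) hx⟩
    exact MilnorKStar.swCoeff_eq_zero_of_mem_pow F (n := 1) (Ideal.pow_le_pow_right (by norm_num) hx) one_pos one_lt_two
  · rintro ⟨h0, h1, h2'⟩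
    have hx1 : x ∈ augIdeal F := (mem_augIdeal_iff F x).2 h0
    have hx2 : x ∈ augIdeal F ^ 2 := (mem_sq_iff_swCoeff_one_eq_zero F h2 hx1).2 h1
    exact (mem_cube_iff_swCoeff_two_eq_zero F h2 hx2).2 h2'

/-- **`s₀ : k₀F = ℤ/2 → W/I` is injective** (`W/I = ℤ/2`: an integer lies in `I` iff it is even). [cite: Milnor1970, §4 Theorem 4.1 «every s_n is surjective», the groups IⁿF/Iⁿ⁺¹F (p0014 L27–L35); «Î […] maps bijectively to a maximal ideal in W» (p0014 L20–L22)] -/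
theorem sHom_zero_injective : Function.Injective (sHom F 0) := by
  refine (injective_iff_map_eq_zero _).2 fun x hx => ?_
  obtain ⟨z, rfl⟩ := MilnorK.kmk_surjective x
  have hz : z = (MilnorK.zeroEquiv F z) • MilnorK.symbol (Fin.elim0 : Fin 0 → Fˣ) := by
    apply (MilnorK.zeroEquiv F).injective
    rw [map_zsmul, MilnorK.zeroEquiv_symbol, smul_eq_mul, mul_one]
  rw [hz, map_zsmul, ← MilnorK.kSymbol_def, map_zsmul, sHom_zero_kSymbol, zsmul_eq_mul, mul_one] at hx
  have h1 : grMk F 0 (MilnorK.zeroEquiv F z : WittRing F) (intCast_mem_pow_zero F _) = 0 := by rw [grMk_int]; exact hx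
  rw [grMk_eq_zero_iff, zero_add, pow_one, mem_fundIdeal_iff, map_intCast, ZMod.intCast_zmod_eq_zero_iff_dvd] at h1
  rw [hz, map_zsmul]
  exact MilnorK.kmk_zsmul_even (even_iff_two_dvd.2 (by exact_mod_cast h1)) _

/-- **`s₀ : k₀F ≅ W/I`**: every class of `W/I = I⁰/I¹` has exactly one preimage under `s₀`. [cite: Milnor1970, §4 Theorem 4.1 (p0014 L27–L35)] -/
theorem existsUnique_sHom_zero_eq (y : WittRing F) (hy : y ∈ fundIdeal F ^ 0) :
    ∃! x : MilnorK.Mod2 F 0, sHom F 0 x = grMk F 0 y hy := by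
  obtain ⟨x, hx⟩ := exists_sHom_eq F y hy
  exact ⟨x, hx, fun x' hx' => sHom_zero_injective F (hx'.trans hx.symm)⟩

end WittRing

end Field

end Literature.RingTheory.KTheory

end
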